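import Summits.Ventures.GridStability.Bench.CHIANG3Deg4ARecertDDeg4A8eqbLowhRoa
import Summits.Ventures.GridStability.Bench.CHIANG3Deg2ARecertDA8eqbRoaModel
import HarnessLib

/-!
# G1.a′+ «CHIANG3 deg-4»-roa (model half) — no pole slip and return to synchronism FOR model-1's infinite-bus model of the
# Chiang 2011 / Anghel 2013 3-machine cycle (`Chiang3.data.IsInfBusSolutionOn`), from the DEGREE-4 certificate

Venture GRIDFUSION, PARTITION A8 (rung G1.a′, «+» row deg-4), A5/A6; lead g8 RULING 9i (7)(C); seat gridfusion-lyap-2 (g4), generator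
`gen_chiang4.py`. Sibling of `CHIANG3Deg4ARecertDDeg4A8eqbLowhRoa.lean` (recast half: `deg4_A_recertD_deg4_A8eqb_lowh_roa`, level `49199/50000`, arcs `κ₁, κ₂ ≤ 3/2`), which it
imports, and BRIDGE on lyap-1's deg-2 model half `Bench/CHIANG3Deg2ARecertDA8eqbRoaModel.lean` (pattern of #62 `WSCC9Deg4ASosgramDinstRoaModel` /
#50 `KUNDUR2ACSGDeg4AOwnVDeg4Nu4ibk3m1PpRoaModel` p541362): the deg-4 certificate rides on the SAME recast field (both = model-1's
`Chiang3.field` verbatim; `gen_chiang4.py` read-back: the six `…_f_<var>_poly` and two `…_h_j_poly` literals of the two Data files are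
equal term for term) and the SAME embedding `deg2_A_recertD_A8eqb_Z δs x = (sin u₁, 1 − cos u₁, sin u₂, 1 − cos u₂, ω₁ − ω₀, ω₂ − ω₀)`, so
model-1's exact chain rule (`Chiang3.data.hasDerivWithinAt_embedInf`, packaged by lyap-1 as `deg2_A_recertD_A8eqb_hasDerivWithinAt_Z` with the
faithfulness decides `deg2_A_recertD_A8eqb_gk_eval_k`) is imported, not redone: `deg4_A_recertD_deg4_A8eqb_lowh_F_eq_F`, `deg4_A_recertD_deg4_A8eqb_lowh_M_eq_M`.

THREE COLUMNS. CERTIFIED: the deg-4 Bench identities (consumed through `deg4_A_recertD_deg4_A8eqb_lowh_roa`). MODELLED: every theorem here is about model-1's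
2-machine + infinite-bus classical model (`RecastData.IsInfBusSolutionOn δ₀`: bus angle frozen at `δ₀`, bus speed deviation `0`,
machines `1, 2` follow `ClassicalSwing.field` of `Chiang3.data.toModel`; exact data of `Chiang3.data`, equilibrium angles `δs` with
`Chiang3.data.EqData δs` — PARTITION A1′; MODEL-VALIDITY row in the Bench file: Chiang–Chu–Cauley 3-machine test system as typed by model-1 (`Models/Chiang3.lean`: machine 3 = reference / infinite bus, network-reduced classical model with LOSSLESS couplings — transfer conductances `G = 0`, susceptances `B = (1, 1/2, 1/2)`, unit voltages — damping `D = (2/5, 1/2)`, dimensionless `M = 1`; the word «lossy» in the Bench certificate file's header is a template slip, the typed data decide `G = 0`),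
instance eq=b at the exact SEP; speeds in the model's dimensionless units). VALIDATED: nothing (the comparison with the printed ROA figures is
sos-3's VALIDATED column). No sentence here says a grid is stable; «region of attraction» = the stated set of initial conditions OF
THE MODEL is carried to the model's equilibrium.

STATEMENT (`deg4_A_recertD_deg4_A8eqb_lowh_model_roa`): for every `0 < γ ≤ 49199/50000` and every infinite-bus solution `c` on `[0, ∞)` whose recast initial
state satisfies `V₄ ≤ γ` (the DEGREE-4 `V`) and `|u₁(0)|, |u₂(0)| < π`: `V₄ ≤ γ` along the recast state for all `t ≥ 0`; `|u₁(t)|,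
|u₂(t)| < π` for all `t ≥ 0` (no pole slip); `u₁(t), u₂(t) → 0` and the machine speed deviations `ω₁(t), ω₂(t) → 0`.
-/

namespace Summit.Ventures.GridStability.Bench.CHIANG3

open Set Filter Metric Topology Real
open Summit.Ventures.GridStability.Lyapunov Summit.Ventures.GridStability.Models
open Literature.Computation.Certificates Literature.Computation.Certificates.SOS

noncomputable section

/-! ### The deg-4 certificate rides on the SAME recast field / constraints / embedding as the deg-2 companion -/

/-- The two Bench certificates of the instance carry the SAME recast field (both = model-1's `Chiang3.field` verbatim, interface
I2; `simp` with the two files' `_eq` lemmas normalises both sides): `deg4_A_recertD_deg4_A8eqb_lowh_F = deg2_A_recertD_A8eqb_F`. [folklore] -/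
theorem deg4_A_recertD_deg4_A8eqb_lowh_F_eq_F : deg4_A_recertD_deg4_A8eqb_lowh_F = deg2_A_recertD_A8eqb_F := by
  funext z i
  fin_cases i <;>
    simp [deg4_A_recertD_deg4_A8eqb_lowh_F, deg2_A_recertD_A8eqb_F,
      deg4_A_recertD_deg4_A8eqb_lowh_f_sigma_1_eq,
      deg4_A_recertD_deg4_A8eqb_lowh_f_kappa_1_eq,
      deg4_A_recertD_deg4_A8eqb_lowh_f_sigma_2_eq,
      deg4_A_recertD_deg4_A8eqb_lowh_f_kappa_2_eq,
      deg4_A_recertD_deg4_A8eqb_lowh_f_omega_1_eq,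
      deg4_A_recertD_deg4_A8eqb_lowh_f_omega_2_eq,
      deg2_A_recertD_A8eqb_f_sigma_1_eq,
      deg2_A_recertD_A8eqb_f_kappa_1_eq,
      deg2_A_recertD_A8eqb_f_sigma_2_eq,
      deg2_A_recertD_A8eqb_f_kappa_2_eq,
      deg2_A_recertD_A8eqb_f_omega_1_eq,
      deg2_A_recertD_A8eqb_f_omega_2_eq]

/-- … and the SAME constraint set `{h₁ = h₂ = 0}`: `deg4_A_recertD_deg4_A8eqb_lowh_M = deg2_A_recertD_A8eqb_M`. [folklore] -/
theorem deg4_A_recertD_deg4_A8eqb_lowh_M_eq_M : deg4_A_recertD_deg4_A8eqb_lowh_M = deg2_A_recertD_A8eqb_M := by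
  ext z
  simp only [deg4_A_recertD_deg4_A8eqb_lowh_M, deg2_A_recertD_A8eqb_M, mem_setOf_eq,
    deg4_A_recertD_deg4_A8eqb_lowh_h1_eq, deg4_A_recertD_deg4_A8eqb_lowh_h2_eq, deg2_A_recertD_A8eqb_h1_eq, deg2_A_recertD_A8eqb_h2_eq]

/-- **Exact embedding along infinite-bus solutions** for THIS Bench field: along every infinite-bus solution `c` of
`Chiang3.data` on `s`, the relative recast curve `t ↦ Z δs (c t)` (lyap-1's `deg2_A_recertD_A8eqb_Z`) solves `ż = F(z)` with `deg4_A_recertD_deg4_A8eqb_lowh_F` — from the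
companion's `deg2_A_recertD_A8eqb_hasDerivWithinAt_Z` and `…_F_eq_F`. [folklore] -/
theorem deg4_A_recertD_deg4_A8eqb_lowh_hasDerivWithinAt_Z {δs : Fin 3 → ℝ} (hEq : Chiang3.data.EqData δs) {δ₀ : ℝ}
    {c : ℝ → ClassicalSwing.State 3} {s : Set ℝ} (hc : Chiang3.data.IsInfBusSolutionOn δ₀ c s)
    {t : ℝ} (ht : t ∈ s) :
    HasDerivWithinAt (fun τ ↦ deg2_A_recertD_A8eqb_Z δs (c τ)) (deg4_A_recertD_deg4_A8eqb_lowh_F (deg2_A_recertD_A8eqb_Z δs (c t))) s t := by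
  rw [deg4_A_recertD_deg4_A8eqb_lowh_F_eq_F]
  exact deg2_A_recertD_A8eqb_hasDerivWithinAt_Z hEq hc ht

/-- The relative recast state of any machine state lies on THIS file's constraint set `M`. [folklore] -/
theorem deg4_A_recertD_deg4_A8eqb_lowh_Z_mem_M (δs : Fin 3 → ℝ) (x : ClassicalSwing.State 3) : deg2_A_recertD_A8eqb_Z δs x ∈ deg4_A_recertD_deg4_A8eqb_lowh_M := by
  rw [deg4_A_recertD_deg4_A8eqb_lowh_M_eq_M]
  exact deg2_A_recertD_A8eqb_Z_mem_M δs x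

/-! ### The ROA sentence in machine coordinates -/

/-- **G1.a′+ «CHIANG3 deg-4»-roa in original coordinates (2 machines + infinite bus), with angle recovery (A6).** For every
`0 < γ ≤ 49199/50000`, every `δs` with `Chiang3.data.EqData δs`, every bus angle `δ₀` and every infinite-bus solution `c` on `[0, ∞)`
with `V₄(Z δs (c 0)) ≤ γ` and `|u_i(0)| < π` (`i = 1, 2`): the certified piece of the DEGREE-4 certificate is never left, no rotor
angle deviation reaches `±π`, `u_i(t) → 0` and `ω_i(t) → 0`. See the module docstring for the three columns. [folklore] -/
theorem deg4_A_recertD_deg4_A8eqb_lowh_model_roa {δs : Fin 3 → ℝ} (hEq : Chiang3.data.EqData δs) {δ₀ : ℝ}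
    {γ : ℝ} (hγ0 : 0 < γ) (hγ : γ ≤ deg4_A_recertD_deg4_A8eqb_lowh_level)
    {c : ℝ → ClassicalSwing.State 3} (hc : Chiang3.data.IsInfBusSolutionOn δ₀ c (Ici 0))
    (h0V : deg4_A_recertD_deg4_A8eqb_lowh_Vz (deg2_A_recertD_A8eqb_Z δs (c 0)) ≤ γ)
    (h0win : ∀ i : Fin 2, |RecastData.u δs (c 0) i.succ| < π) :
    (∀ t, 0 ≤ t → deg4_A_recertD_deg4_A8eqb_lowh_Vz (deg2_A_recertD_A8eqb_Z δs (c t)) ≤ γ) ∧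
    (∀ i : Fin 2, ∀ t, 0 ≤ t → |RecastData.u δs (c t) i.succ| < π) ∧
    (∀ i : Fin 2, Tendsto (fun t ↦ RecastData.u δs (c t) i.succ) atTop (𝓝 0)) ∧
    (∀ i : Fin 2, Tendsto (fun t ↦ (c t).2 i.succ) atTop (𝓝 0)) := by
  -- componentwise continuity of the solution on `[0, ∞)`
  have h1c : ∀ j, ContinuousOn (fun τ ↦ (c τ).1 j) (Ici 0) := by
    intro j t ht
    by_cases hj : j = 0
    · subst hj
      exact (continuousWithinAt_const (b := δ₀)).congr (fun τ hτ ↦ (hc τ hτ).1) (hc t ht).1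
    · exact ((hc t ht).2.2 j hj).1.continuousWithinAt
  have h2c : ∀ j, ContinuousOn (fun τ ↦ (c τ).2 j) (Ici 0) := by
    intro j t ht
    by_cases hj : j = 0
    · subst hj
      exact (continuousWithinAt_const (b := (0 : ℝ))).congr (fun τ hτ ↦ (hc τ hτ).2.1) (hc t ht).2.1
    · exact ((hc t ht).2.2 j hj).2.continuousWithinAt
  have hu : ∀ i : Fin 2, ContinuousOn (fun t ↦ RecastData.u δs (c t) i.succ) (Ici 0) := by
    intro i
    simp only [RecastData.u]
    exact ((h1c _).sub (h1c 0)).sub continuousOn_const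
  set z : ℝ → Fin 6 → ℝ := fun τ ↦ deg2_A_recertD_A8eqb_Z δs (c τ) with hzdef
  have hzc : ContinuousOn z (Ici 0) := by
    refine continuousOn_pi.2 fun k ↦ ?_
    fin_cases k
    · show ContinuousOn (fun t ↦ sin (RecastData.u δs (c t) 1)) (Ici 0)
      exact Real.continuous_sin.comp_continuousOn (hu 0)
    · show ContinuousOn (fun t ↦ 1 - cos (RecastData.u δs (c t) 1)) (Ici 0)
      exact continuousOn_const.sub (Real.continuous_cos.comp_continuousOn (hu 0))
    · show ContinuousOn (fun t ↦ sin (RecastData.u δs (c t) 2)) (Ici 0)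
      exact Real.continuous_sin.comp_continuousOn (hu 1)
    · show ContinuousOn (fun t ↦ 1 - cos (RecastData.u δs (c t) 2)) (Ici 0)
      exact continuousOn_const.sub (Real.continuous_cos.comp_continuousOn (hu 1))
    · show ContinuousOn (fun t ↦ (c t).2 1 - (c t).2 0) (Ici 0)
      exact (h2c 1).sub (h2c 0)
    · show ContinuousOn (fun t ↦ (c t).2 2 - (c t).2 0) (Ici 0)
      exact (h2c 2).sub (h2c 0)
  have hz : ∀ t, 0 ≤ t → HasDerivWithinAt z (deg4_A_recertD_deg4_A8eqb_lowh_F (z t)) (Ici t) t := fun t ht ↦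
    (deg4_A_recertD_deg4_A8eqb_lowh_hasDerivWithinAt_Z hEq hc ht).mono (Ici_subset_Ici.2 ht)
  obtain ⟨hinv, hlim⟩ := deg4_A_recertD_deg4_A8eqb_lowh_roa hγ0 hγ hzc hz (deg4_A_recertD_deg4_A8eqb_lowh_Z_mem_M δs (c 0)) h0V
  have hall := tendsto_pi_nhds.1 hlim
  -- no pole slip: `κ_i ≤ 3/2 < 2` gives `cos u_i > -1`
  have hcos : ∀ i : Fin 2, ∀ t, 0 ≤ t → -1 < cos (RecastData.u δs (c t) i.succ) := by
    intro i t ht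
    obtain ⟨-, hk1, hk2⟩ := hinv t ht
    fin_cases i
    · simp only [hzdef, deg2_A_recertD_A8eqb_Z_1] at hk1
      show -1 < cos (RecastData.u δs (c t) 1)
      linarith
    · simp only [hzdef, deg2_A_recertD_A8eqb_Z_3] at hk2
      show -1 < cos (RecastData.u δs (c t) 2)
      linarith
  have hwin : ∀ i : Fin 2, ∀ t, 0 ≤ t → |RecastData.u δs (c t) i.succ| < π := fun i ↦
    abs_lt_pi_of_neg_one_lt_cos (hu i) (h0win i) (hcos i)
  refine ⟨fun t ht ↦ (hinv t ht).1, hwin, fun i ↦ ?_, fun i ↦ ?_⟩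
  · fin_cases i
    · have h := hall 1
      simp only [hzdef, deg2_A_recertD_A8eqb_Z_1] at h
      exact tendsto_zero_of_one_sub_cos_tendsto (hwin 0) h
    · have h := hall 3
      simp only [hzdef, deg2_A_recertD_A8eqb_Z_3] at h
      exact tendsto_zero_of_one_sub_cos_tendsto (hwin 1) h
  · -- speeds: `z_(4+i) = ω_(i+1) − ω_0 → 0` and `ω_0 = 0` on `[0, ∞)`
    have hω0 : ∀ᶠ t in atTop, (c t).2 0 = 0 := by
      filter_upwards [eventually_ge_atTop (0 : ℝ)] with t ht using (hc t ht).2.1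
    fin_cases i
    · have h := hall 4
      simp only [hzdef, deg2_A_recertD_A8eqb_Z_4] at h
      refine (h.congr' ?_)
      filter_upwards [hω0] with t ht
      show (c t).2 1 - (c t).2 0 = (c t).2 (Fin.succ 0)
      simp [ht]
    · have h := hall 5
      simp only [hzdef, deg2_A_recertD_A8eqb_Z_5] at h
      refine (h.congr' ?_)
      filter_upwards [hω0] with t ht
      show (c t).2 2 - (c t).2 0 = (c t).2 (Fin.succ 1)
      simp [ht]

end

end Summit.Ventures.GridStability.Bench.CHIANG3
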